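import Literature.NumberTheory.LFunctions.ImaginaryQuadraticClassNumberHalfLogBound
import HarnessLib

/-!
# Benli–Goel–Twiss–Zaman 2025, Lemma 2.9 for PRIMITIVE quadratic characters WITH THE PRINTED CONSTANTS,
# unconditionally (`0.72 (1 − β₁) ≤ L(1,χ₁) ≤ 0.18 log² q (1 − β₁)`), and the CONDITIONALS I.1 class-number
# line `0.36/π · w_K √q (1−β₁) ≤ h_K ≤ 0.09/π · w_K √q log² q (1−β₁)` WITHOUT the named fact `BGTZ2025.lemma29`

Topic `Literature/NumberTheory/LFunctions` (namespace `Literature.NumberTheory.LFunctions`; cell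
`parity-realchar`, D-0088 (4) literature-typing row (7) «conditionals column + instrument provenance»,
seat `littype-FP2-1`). Everything is PROVED (standard axioms); no definition, no named fact.

K. Benli, S. Goel, H. Twiss, A. Zaman, Proc. Amer. Math. Soc. 154 (2026) 509–525 = arXiv:2410.06082,
**Lemma 2.9** (typed verbatim as the named fact `BGTZ2025.lemma29`, `ExplicitDeuringHeilbronnDirichlet.lean`):
«Let `q > 400 000` be an integer. If `1 − 1/(10 log q) < β₁ < 1` is a real zero of `L(s, χ₁)` where `χ₁ (mod q)`
is a real quadratic character, then `0.72 ≤ L(1,χ₁)/(1 − β₁) ≤ 0.18 (log q)²`.» Its printed proof rests on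
Platt 2016 (for `q > 4·10⁵`), on the source's §3 (lower half) and on Bordignon 2019 Thm 1.2 (upper half, via
Frolenkov–Soundararajan's Pólya–Vinogradov constant — the tree's `BGTZ2025.lemma29_upper_primitive_of_fs`,
modulo the named fact `frolenkovSoundararajan2013_pv`; the FS-free kernel form had the constant `½`,
`BGTZ2025.lemma29_upper_primitive`). The cell's ruling E-lemma29-upper (CONDITIONALS v1.3r) records that
print supports the upper half for PRIMITIVE `χ₁` only.

**This file proves Lemma 2.9 for primitive quadratic `χ₁` with the printed constants `0.72` / `0.18`,
for every `q ≥ 10⁴`, with NO named fact** (no Platt table, no Pólya–Vinogradov constant):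

* lower half — the tree's kernel `RealZeroRepulsion.lOne_ge_of_realZero_tenth` (`0.81 (1 − β) ≤ L(1,χ)`,
  primitive quadratic `χ` mod `q ≥ 10⁴`, `β ≥ 1 − 1/(10 log q)`; Montgomery–Vaughan (11.10) made explicit);
* upper half — **Louboutin, Acta Arith. 121 (2006) Theorem 1 (ii) (3), AS PRINTED**, both parities:
  `|L(1,χ)| ≤ (1 − β) log² q/8` for every primitive quadratic `χ` with a real zero `β ∈ (0,1)` (even:
  `Louboutin2001.norm_LFunction_one_le_of_zero`, `DirichletLOneRealZeroBoundEvenQuadratic.lean`; odd: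
  `Louboutin2001.norm_LFunction_one_le_of_zero_of_odd_sharp`, `DirichletLOneHalfLogBoundOddSharp.lean`,
  2026-08-29) — `1/8 = 0.125 < 0.18`, valid for EVERY `β₁ ∈ (0,1)` (no window) and every `q`.

Declarations: `Louboutin2001.norm_LFunction_one_le_of_zero_of_isPrimitive_sharp` (parity-free printed (3)),
`Louboutin2001.LFunction_one_re_pos_and_le_of_zero_of_isPrimitive_sharp`; `BGTZ2025.lemma29_upper_primitive_sharp`
(`Re L(1,χ₁) ≤ (1/8) log² q (1 − β₁)`, all `q`, all `β₁ ∈ (0,1)`), `BGTZ2025.lemma29_upper_primitive_printed`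
(`0.18`), `BGTZ2025.lemma29_primitive_kernel` (`0.81` / `1/8`, `q ≥ 10⁴`), `BGTZ2025.lemma29_primitive`
(`0.72` / `0.18`, `q ≥ 10⁴`), `BGTZ2025.lemma29_primitive'` (the named fact's own binder shape restricted to
primitive `χ₁`, `q > 4·10⁵` — supersedes `BGTZ2025.lemma29_primitive_of_platt`, which needed
`platt2016_theorem71` and had `½`); on the column's predicate: `norm_LFunction_one_le_of_isSiegelZero_sharp`
(`IsSiegelZero χ η`, `q ≥ 2` ⇒ `‖L(1,χ)‖ ≤ log q/(8η)`; the tree had `55 log q/η`),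
`norm_LFunction_one_two_sided_of_isSiegelZero` (`q ≥ 10⁴`: `0.81/(η log q) ≤ ‖L(1,χ)‖ ≤ log q/(8η)`);
class numbers (imaginary quadratic `K`, odd `d_K`, `χ_{d_K}` = the Jacobi character mod `q = |d_K|`):
`classNumber_bounds_of_landauSiegelZero'` — **the statement of the CONDITIONALS I.1 decl
`classNumber_bounds_of_landauSiegelZero` (`SiegelZeroClassNumberBound.lean`) WITHOUT its hypothesis
`(h29 : BGTZ2025.lemma29)`** (`w_K = 2`; `0.72 ≤ 0.81`, `0.18 ≥ 1/8`; from the kernel two-sided line v5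
`Louboutin2001.classNumber_two_sided_of_realZero_explicit_v5`), and `classNumber_bounds_of_isSiegelZero_sharp`
(`0.81 √q/(π η log q) ≤ h_K ≤ √q log q/(8π η)`; the tree's `classNumber_bounds_of_isSiegelZero` has `55/π`).

Scope notes. «real quadratic character» = `χ₁.IsQuadratic` (values in `{0, ±1}`); primitivity is the extra
hypothesis relative to print (imprimitive `χ₁`: the lower half for every quadratic `χ₁ ≠ χ₀` modulo Platt's
table is `BGTZ2025.lemma29_lower_of_platt`; the upper half is unsupported in print, ruling E-lemma29-upper).
`L(1,χ₁)` is real for quadratic `χ₁`; as in the named fact the inequalities are stated on `Re L(1,χ₁)`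
(and on `‖L(1,χ₁)‖` where convenient; `0 < L(1,χ₁)` is `Siegel.LFunction_one_re_pos`).

## References

* [BenliGoelTwissZaman2025] K. Benli, S. Goel, H. Twiss, A. Zaman, Proc. Amer. Math. Soc. 154 (2026)
  509–525, arXiv:2410.06082 — Lemma 2.9.
* [Louboutin2006RelativeClassNumbers] S. Louboutin, Acta Arith. 121 (2006) 199–220 — Theorem 1 (ii) (3) p. 200.
* [MontgomeryVaughan2007] H. L. Montgomery, R. C. Vaughan, *Multiplicative Number Theory I*, §11.2 (11.10).
* [TaoTeravainen2021] T. Tao, J. Teräväinen, J. London Math. Soc. 106 (2022) — Definition 1.4 (`IsSiegelZero`).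
* [NeukirchANT1999] J. Neukirch, *Algebraic Number Theory*, Ch. VII §5 (5.11) (class number formula).
-/

noncomputable section

open Complex Real
open Literature.Barriers.Parity

namespace Literature.NumberTheory.LFunctions

open DirichletCharacter Literature.NumberTheory.QuadraticFields
  Literature.NumberTheory.QuadraticFields.Quadratic

/-! ### Louboutin 2006 Theorem 1 (ii) (3), parity-free, AS PRINTED -/

namespace Louboutin2001

variable {q : ℕ} [NeZero q] {χ : DirichletCharacter ℂ q}

/-- **Louboutin 2006, Theorem 1 (ii) (3), quadratic case, AS PRINTED, both parities:** for a primitive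
quadratic `χ ≠ 1` mod `q`, a real zero `L(β, χ) = 0` with `0 < β < 1` gives **`|L(1, χ)| ≤ (1 − β) log² q/8`**
(even: `norm_LFunction_one_le_of_zero`; odd: `norm_LFunction_one_le_of_zero_of_odd_sharp`). Supersedes
`norm_LFunction_one_le_of_zero_of_isPrimitive` (`(log q + ½)²`). [cite: Louboutin2006RelativeClassNumbers, Thm 1 (3) p. 200] -/
theorem norm_LFunction_one_le_of_zero_of_isPrimitive_sharp (hprim : χ.IsPrimitive) (hχ : χ ≠ 1)
    (hquad : χ.IsQuadratic) {β : ℝ} (hβ0 : 0 < β) (hβ1 : β < 1) (hzero : χ.LFunction β = 0) :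
    ‖χ.LFunction 1‖ ≤ (1 - β) * Real.log q ^ 2 / 8 := by
  rcases χ.even_or_odd with heven | hodd
  · exact norm_LFunction_one_le_of_zero hprim hχ heven hquad hβ0 hβ1 hzero
  · exact norm_LFunction_one_le_of_zero_of_odd_sharp hprim hodd hquad hβ0 hβ1 hzero

/-- `0 < L(1, χ) ≤ (1 − β) log² q/8` on the real part (quadratic primitive `χ ≠ 1`, real zero `β ∈ (0,1)`).
[cite: Louboutin2006RelativeClassNumbers, Thm 1 (3) p. 200] -/
theorem LFunction_one_re_pos_and_le_of_zero_of_isPrimitive_sharp (hprim : χ.IsPrimitive) (hχ : χ ≠ 1)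
    (hquad : χ.IsQuadratic) {β : ℝ} (hβ0 : 0 < β) (hβ1 : β < 1) (hzero : χ.LFunction β = 0) :
    0 < (χ.LFunction 1).re ∧ (χ.LFunction 1).re ≤ (1 - β) * Real.log q ^ 2 / 8 :=
  ⟨Siegel.LFunction_one_re_pos χ hχ hquad.sq_eq_one, (Complex.re_le_norm _).trans
    (norm_LFunction_one_le_of_zero_of_isPrimitive_sharp hprim hχ hquad hβ0 hβ1 hzero)⟩

end Louboutin2001

/-! ### BGTZ 2025 Lemma 2.9 for primitive quadratic characters, printed constants, no named fact -/

section BGTZ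

/-- `9 ≤ log q` for `q ≥ 10⁴` (`e⁹ < 8104 < 10⁴`). [folklore] -/
private theorem nine_le_log_of_ge {q : ℕ} (hq : 10 ^ 4 ≤ q) : (9 : ℝ) ≤ Real.log q := by
  have hq' : (10 ^ 4 : ℝ) ≤ q := by exact_mod_cast hq
  rw [Real.le_log_iff_exp_le (by linarith)]
  have h3 : Real.exp 9 = Real.exp 1 ^ 9 := by rw [← Real.exp_nat_mul]; norm_num
  have he : Real.exp 1 < 2.7182818286 := Real.exp_one_lt_d9
  have h9 : Real.exp 1 ^ 9 < (2.7182818286 : ℝ) ^ 9 :=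
    pow_lt_pow_left₀ he (Real.exp_pos 1).le (by norm_num)
  rw [h3]; nlinarith

variable {q : ℕ} [NeZero q] {χ₁ : DirichletCharacter ℂ q}

/-- A primitive character of modulus `q ≥ 2` is not the trivial character. [folklore] -/
private theorem ne_one_of_isPrimitive_two_le (hq : 2 ≤ q) (hprim : χ₁.IsPrimitive) : χ₁ ≠ 1 := by
  rintro rfl
  rw [DirichletCharacter.isPrimitive_def, DirichletCharacter.conductor_one] at hprim
  omega

/-- **BGTZ 2025 Lemma 2.9, UPPER half for PRIMITIVE quadratic `χ₁`, with the constant `1/8` — every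
modulus, every real zero `β₁ ∈ (0,1)`:** `Re L(1,χ₁) ≤ (1/8) log² q · (1 − β₁)` (Louboutin's Theorem 1 (ii)
(3) as printed, both parities). Sharpens `BGTZ2025.lemma29_upper_primitive` (`½`, `q > 4·10⁵`, window
`1 − 1/(10 log q)`) and makes `BGTZ2025.lemma29_upper_primitive_of_fs` (`0.18` modulo Frolenkov–Soundararajan)
unconditional. [cite: BenliGoelTwissZaman2025, Lemma 2.9] [cite: Louboutin2006RelativeClassNumbers, Thm 1 (3) p. 200] -/
theorem BGTZ2025.lemma29_upper_primitive_sharp (hprim : χ₁.IsPrimitive) (hquad : χ₁.IsQuadratic)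
    (hne : χ₁ ≠ 1) {β₁ : ℝ} (hβ0 : 0 < β₁) (hβ1 : β₁ < 1) (hz : χ₁.LFunction β₁ = 0) :
    (χ₁.LFunction 1).re ≤ 1 / 8 * Real.log q ^ 2 * (1 - β₁) := by
  have h := (Complex.re_le_norm _).trans
    (Louboutin2001.norm_LFunction_one_le_of_zero_of_isPrimitive_sharp hprim hne hquad hβ0 hβ1 hz)
  calc (χ₁.LFunction 1).re ≤ (1 - β₁) * Real.log q ^ 2 / 8 := h
    _ = 1 / 8 * Real.log q ^ 2 * (1 - β₁) := by ring

/-- **The printed constant:** `Re L(1,χ₁) ≤ 0.18 log² q · (1 − β₁)` for every primitive quadratic `χ₁ ≠ χ₀`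
with a real zero `β₁ ∈ (0,1)` — unconditionally (`1/8 < 0.18`). [cite: BenliGoelTwissZaman2025, Lemma 2.9] -/
theorem BGTZ2025.lemma29_upper_primitive_printed (hprim : χ₁.IsPrimitive) (hquad : χ₁.IsQuadratic)
    (hne : χ₁ ≠ 1) {β₁ : ℝ} (hβ0 : 0 < β₁) (hβ1 : β₁ < 1) (hz : χ₁.LFunction β₁ = 0) :
    (χ₁.LFunction 1).re ≤ 0.18 * Real.log q ^ 2 * (1 - β₁) := by
  have h := BGTZ2025.lemma29_upper_primitive_sharp hprim hquad hne hβ0 hβ1 hz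
  have h0 : 0 ≤ Real.log q ^ 2 * (1 - β₁) := mul_nonneg (sq_nonneg _) (by linarith)
  nlinarith

/-- **BGTZ 2025 Lemma 2.9 for PRIMITIVE quadratic `χ₁`, kernel constants, `q ≥ 10⁴`:** a real zero
`β₁ ∈ (1 − 1/(10 log q), 1)` of `L(s,χ₁)` gives `0.81 (1 − β₁) ≤ Re L(1,χ₁) ≤ (1/8) log² q · (1 − β₁)` — no
named fact. [cite: BenliGoelTwissZaman2025, Lemma 2.9] [cite: MontgomeryVaughan2007, §11.2 (11.10)]
[cite: Louboutin2006RelativeClassNumbers, Thm 1 (3) p. 200] -/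
theorem BGTZ2025.lemma29_primitive_kernel (hq : 10 ^ 4 ≤ q) (hprim : χ₁.IsPrimitive)
    (hquad : χ₁.IsQuadratic) {β₁ : ℝ} (hlo : 1 - 1 / (10 * Real.log q) < β₁) (hβ1 : β₁ < 1)
    (hz : χ₁.LFunction β₁ = 0) :
    0.81 * (1 - β₁) ≤ (χ₁.LFunction 1).re ∧ (χ₁.LFunction 1).re ≤ 1 / 8 * Real.log q ^ 2 * (1 - β₁) := by
  have hne : χ₁ ≠ 1 := ne_one_of_isPrimitive_two_le (le_trans (by norm_num) hq) hprim
  have hL9 := nine_le_log_of_ge hq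
  have hβ0 : 0 < β₁ := by
    have : 1 / (10 * Real.log (q : ℝ)) ≤ 1 / 90 := by
      apply one_div_le_one_div_of_le (by norm_num); linarith
    linarith
  exact ⟨RealZeroRepulsion.lOne_ge_of_realZero_tenth χ₁ hq hprim hquad hz hlo.le,
    BGTZ2025.lemma29_upper_primitive_sharp hprim hquad hne hβ0 hβ1 hz⟩

/-- **BGTZ 2025 Lemma 2.9 for PRIMITIVE quadratic `χ₁`, WITH THE PRINTED CONSTANTS, unconditionally:**
for `q ≥ 10⁴` (in particular for the print's `q > 4·10⁵`), `χ₁` mod `q` primitive and quadratic, and a real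
zero `β₁ ∈ (1 − 1/(10 log q), 1)` of `L(s,χ₁)`: **`0.72 (1 − β₁) ≤ L(1,χ₁) ≤ 0.18 log² q · (1 − β₁)`.**
No Platt table, no Pólya–Vinogradov constant: lower half `RealZeroRepulsion.lOne_ge_of_realZero_tenth` (`0.81`),
upper half Louboutin's printed (3) (`1/8`). [cite: BenliGoelTwissZaman2025, Lemma 2.9] -/
theorem BGTZ2025.lemma29_primitive (hq : 10 ^ 4 ≤ q) (hprim : χ₁.IsPrimitive) (hquad : χ₁.IsQuadratic)
    {β₁ : ℝ} (hlo : 1 - 1 / (10 * Real.log q) < β₁) (hβ1 : β₁ < 1) (hz : χ₁.LFunction β₁ = 0) :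
    0.72 * (1 - β₁) ≤ (χ₁.LFunction 1).re ∧ (χ₁.LFunction 1).re ≤ 0.18 * Real.log q ^ 2 * (1 - β₁) := by
  obtain ⟨hlow, hup⟩ := BGTZ2025.lemma29_primitive_kernel hq hprim hquad hlo hβ1 hz
  have h1 : 0 ≤ 1 - β₁ := by linarith
  have h0 : 0 ≤ Real.log q ^ 2 * (1 - β₁) := mul_nonneg (sq_nonneg _) h1
  constructor <;> nlinarith

/-- **Lemma 2.9 in the named fact's own binder shape, restricted to primitive `χ₁` — hypothesis-free**
(supersedes `BGTZ2025.lemma29_primitive_of_platt`: no `platt2016_theorem71`, and `0.18` for `½`).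
[cite: BenliGoelTwissZaman2025, Lemma 2.9] -/
theorem BGTZ2025.lemma29_primitive' :
    ∀ (q : ℕ) [NeZero q], 400000 < q → ∀ χ₁ : DirichletCharacter ℂ q, χ₁.IsQuadratic → χ₁.IsPrimitive →
      ∀ β₁ : ℝ, 1 - 1 / (10 * Real.log q) < β₁ → β₁ < 1 → χ₁.LFunction β₁ = 0 →
        0.72 * (1 - β₁) ≤ (χ₁.LFunction 1).re ∧
          (χ₁.LFunction 1).re ≤ 0.18 * Real.log q ^ 2 * (1 - β₁) := by
  intro q _ hq χ₁ hquad hprim β₁ hlo hβ1 hz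
  exact BGTZ2025.lemma29_primitive (by omega) hprim hquad hlo hβ1 hz

/-! ### On the column's predicate `IsSiegelZero χ η` -/

/-- **A Siegel zero of quality `η` forces `L(1,χ) ≤ log q/(8η)` (kernel, Louboutin's printed (3)):** for
`χ` mod `q ≥ 2` with `IsSiegelZero χ η` (`χ` primitive quadratic, `η ≥ 10`, `L(1 − 1/(η log q), χ) = 0`),
`‖L(1,χ)‖ ≤ log q/(8η)`. The tree's reading had `55 log q/η` (`norm_LFunction_one_le_mul_log_sq` route).
[cite: TaoTeravainen2021, Definition 1.4] [cite: Louboutin2006RelativeClassNumbers, Thm 1 (3) p. 200] -/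
theorem norm_LFunction_one_le_of_isSiegelZero_sharp (hq : 2 ≤ q) {χ : DirichletCharacter ℂ q} {η : ℝ}
    (hS : IsSiegelZero χ η) : ‖χ.LFunction 1‖ ≤ Real.log q / (8 * η) := by
  obtain ⟨hprim, hquad, h10, hzero⟩ := hS
  have hne : χ ≠ 1 := ne_one_of_isPrimitive_two_le hq hprim
  have hq' : (2 : ℝ) ≤ q := by exact_mod_cast hq
  have hL0 : 0 < Real.log q := Real.log_pos (by linarith)
  have hη0 : 0 < η := by linarith
  set β : ℝ := 1 - 1 / (η * Real.log q) with hβdef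
  have hκ : 1 - β = 1 / (η * Real.log q) := by rw [hβdef]; ring
  have hβ1 : β < 1 := by
    have : 0 < 1 / (η * Real.log q) := by positivity
    linarith
  have hβ0 : 0 < β := by
    -- `η log q ≥ 10 log 2 > 1`
    have hlog2 : (0.6931471803 : ℝ) < Real.log 2 := Real.log_two_gt_d9
    have hl2 : Real.log 2 ≤ Real.log q := Real.log_le_log (by norm_num) hq'
    have hprod : 1 < η * Real.log q := by nlinarith
    have : 1 / (η * Real.log q) < 1 := by rw [div_lt_one (by positivity)]; exact hprod
    linarith
  have h := Louboutin2001.norm_LFunction_one_le_of_zero_of_isPrimitive_sharp hprim hne hquad hβ0 hβ1 hzero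
  rw [hκ] at h
  calc ‖χ.LFunction 1‖ ≤ 1 / (η * Real.log q) * Real.log q ^ 2 / 8 := h
    _ = Real.log q / (8 * η) := by field_simp

/-- **Two-sided, on `IsSiegelZero`:** for `χ` mod `q ≥ 10⁴` with `IsSiegelZero χ η`,
`0.81/(η log q) ≤ ‖L(1,χ)‖ ≤ log q/(8η)` — the zero pins `L(1,χ)` within the factor `log² q/6.48`.
[cite: TaoTeravainen2021, Definition 1.4] [cite: MontgomeryVaughan2007, §11.2 (11.10)]
[cite: Louboutin2006RelativeClassNumbers, Thm 1 (3) p. 200] -/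
theorem norm_LFunction_one_two_sided_of_isSiegelZero (hq : 10 ^ 4 ≤ q) {χ : DirichletCharacter ℂ q}
    {η : ℝ} (hS : IsSiegelZero χ η) :
    0.81 / (η * Real.log q) ≤ ‖χ.LFunction 1‖ ∧ ‖χ.LFunction 1‖ ≤ Real.log q / (8 * η) :=
  ⟨RealZeroRepulsion.norm_LFunction_one_ge_of_isSiegelZero χ hq hS,
    norm_LFunction_one_le_of_isSiegelZero_sharp (le_trans (by norm_num) hq) hS⟩

end BGTZ

/-! ### Class numbers: the CONDITIONALS I.1 line without `BGTZ2025.lemma29` -/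

section ClassNumber

open _root_.NumberField _root_.NumberField.Units Module

variable {K : Type*} [Field K] [NumberField K]

/-- **The CONDITIONALS I.1 decl, hypothesis-free.** This is the statement of
`classNumber_bounds_of_landauSiegelZero` (`SiegelZeroClassNumberBound.lean`) with its first binder
`(h29 : BGTZ2025.lemma29)` REMOVED: for an imaginary quadratic `K` with odd `d_K`, `q = |d_K| > 400 000`, and
a real zero `β₁ ∈ (1 − 1/(10 log q), 1)` of `L(s, χ_{d_K})`,
**`0.36/π · w_K √q (1 − β₁) ≤ h_K ≤ 0.09/π · w_K √q log² q (1 − β₁)`** — from the kernel two-sided line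
`Louboutin2001.classNumber_two_sided_of_realZero_explicit_v5` (`0.81/π`, `1/(8π) log²`) and `w_K = 2`
(`d_K < −4`): `0.36·2 = 0.72 ≤ 0.81`, `0.09·2 = 0.18 ≥ 1/8`. [cite: BenliGoelTwissZaman2025, Lemma 2.9]
[cite: Louboutin2006RelativeClassNumbers, Thm 1 (3) p. 200] [cite: NeukirchANT1999, Ch. VII §5 (5.11)] -/
theorem classNumber_bounds_of_landauSiegelZero' (h2 : finrank ℚ K = 2)
    (hodd : Odd (NumberField.discr K)) (hd : NumberField.discr K < 0)
    (hq : 400000 < (NumberField.discr K).natAbs) {β₁ : ℝ}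
    (hlo : 1 - 1 / (10 * Real.log (NumberField.discr K).natAbs) < β₁) (hhi : β₁ < 1)
    (hz : (jacobiChar (NumberField.discr K).natAbs).LFunction β₁ = 0) :
    0.36 / Real.pi * (torsionOrder K : ℝ) * Real.sqrt (NumberField.discr K).natAbs * (1 - β₁) ≤
        (classNumber K : ℝ) ∧
      (classNumber K : ℝ) ≤
        0.09 / Real.pi * (torsionOrder K : ℝ) * Real.sqrt (NumberField.discr K).natAbs *
          Real.log (NumberField.discr K).natAbs ^ 2 * (1 - β₁) := by
  have _ := hhi
  have hq4 : 10 ^ 4 ≤ (NumberField.discr K).natAbs := by omega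
  have hd4 : NumberField.discr K < -4 := by
    have : (400000 : ℤ) < ((NumberField.discr K).natAbs : ℤ) := by exact_mod_cast hq
    omega
  obtain ⟨hlow, hup⟩ :=
    Louboutin2001.classNumber_two_sided_of_realZero_explicit_v5 h2 hodd hd hq4 hlo.le hz
  have hw : (torsionOrder K : ℝ) = 2 := by
    exact_mod_cast torsionOrder_eq_two_of_discr_lt_neg_four h2 hd4
  rw [hw]
  have hπ := Real.pi_pos
  have h1 : 0 ≤ 1 - β₁ := by linarith
  have hX : 0 ≤ Real.sqrt ((NumberField.discr K).natAbs : ℝ) * (1 - β₁) :=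
    mul_nonneg (Real.sqrt_nonneg _) h1
  have hY : 0 ≤ Real.sqrt ((NumberField.discr K).natAbs : ℝ) *
      Real.log ((NumberField.discr K).natAbs : ℝ) ^ 2 * (1 - β₁) :=
    mul_nonneg (mul_nonneg (Real.sqrt_nonneg _) (sq_nonneg _)) h1
  constructor
  · calc 0.36 / Real.pi * 2 * Real.sqrt ((NumberField.discr K).natAbs : ℝ) * (1 - β₁)
        = 0.72 / Real.pi * (Real.sqrt ((NumberField.discr K).natAbs : ℝ) * (1 - β₁)) := by ring
      _ ≤ 0.81 / Real.pi * (Real.sqrt ((NumberField.discr K).natAbs : ℝ) * (1 - β₁)) :=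
          mul_le_mul_of_nonneg_right (div_le_div_of_nonneg_right (by norm_num) hπ.le) hX
      _ = 0.81 / Real.pi * Real.sqrt ((NumberField.discr K).natAbs : ℝ) * (1 - β₁) := by ring
      _ ≤ (classNumber K : ℝ) := hlow
  · calc (classNumber K : ℝ)
        ≤ 1 / (8 * Real.pi) * Real.sqrt ((NumberField.discr K).natAbs : ℝ) *
            Real.log ((NumberField.discr K).natAbs : ℝ) ^ 2 * (1 - β₁) := hup
      _ = (1 / 8) / Real.pi * (Real.sqrt ((NumberField.discr K).natAbs : ℝ) *
            Real.log ((NumberField.discr K).natAbs : ℝ) ^ 2 * (1 - β₁)) := by ring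
      _ ≤ 0.18 / Real.pi * (Real.sqrt ((NumberField.discr K).natAbs : ℝ) *
            Real.log ((NumberField.discr K).natAbs : ℝ) ^ 2 * (1 - β₁)) :=
          mul_le_mul_of_nonneg_right (div_le_div_of_nonneg_right (by norm_num) hπ.le) hY
      _ = 0.09 / Real.pi * 2 * Real.sqrt ((NumberField.discr K).natAbs : ℝ) *
            Real.log ((NumberField.discr K).natAbs : ℝ) ^ 2 * (1 - β₁) := by ring

/-- **Class number of the exceptional field under a Siegel zero of quality `η`, sharp upper half (kernel).**
For an imaginary quadratic `K` with odd `d_K`, `q = |d_K| ≥ 10⁴`, whose character `χ_{d_K} = jacobiChar q`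
carries `IsSiegelZero χ_{d_K} η`: **`0.81 √q/(π η log q) ≤ h_K ≤ √q log q/(8π η)`** (lower half as in the
tree's `classNumber_bounds_of_isSiegelZero`, whose upper half is `55 √q log q/(π η)`; upper half here from
`Louboutin2001.classNumber_le_of_realZero_explicit_v5`, `w_K = 2`). [cite: TaoTeravainen2021, Definition 1.4]
[cite: Louboutin2006RelativeClassNumbers, Thm 1 (3) p. 200] [cite: NeukirchANT1999, Ch. VII §5 (5.11)] -/
theorem classNumber_bounds_of_isSiegelZero_sharp (h2 : finrank ℚ K = 2)
    (hodd : Odd (NumberField.discr K)) (hd : NumberField.discr K < 0)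
    [NeZero (NumberField.discr K).natAbs] (hq : 10 ^ 4 ≤ (NumberField.discr K).natAbs) {η : ℝ}
    (hS : IsSiegelZero (jacobiChar (NumberField.discr K).natAbs) η) :
    0.81 / Real.pi * Real.sqrt (NumberField.discr K).natAbs / (η * Real.log (NumberField.discr K).natAbs)
        ≤ (classNumber K : ℝ) ∧
      (classNumber K : ℝ) ≤
        1 / (8 * Real.pi) * Real.sqrt (NumberField.discr K).natAbs *
          Real.log (NumberField.discr K).natAbs / η := by
  refine ⟨(classNumber_bounds_of_isSiegelZero h2 hodd hd hq hS).1, ?_⟩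
  set q : ℕ := (NumberField.discr K).natAbs with hqdef
  obtain ⟨hprim, hquad, h10, hzero⟩ := hS
  have hL9 : 9 ≤ Real.log q := nine_le_log_of_ge hq
  have hL0 : 0 < Real.log q := by linarith
  have hη0 : 0 < η := by linarith
  set β : ℝ := 1 - 1 / (η * Real.log q) with hβdef
  have hκ : 1 - β = 1 / (η * Real.log q) := by rw [hβdef]; ring
  have hβ1 : β < 1 := by
    have : 0 < 1 / (η * Real.log q) := by positivity
    linarith
  have hβ0 : 0 < β := by
    have : 1 / (η * Real.log q) ≤ 1 / 90 := by
      apply one_div_le_one_div_of_le (by norm_num); nlinarith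
    rw [hβdef]; linarith
  have hd4 : NumberField.discr K < -4 := by
    have : (10 ^ 4 : ℤ) ≤ ((NumberField.discr K).natAbs : ℤ) := by exact_mod_cast hq
    omega
  have hup := Louboutin2001.classNumber_le_of_realZero_explicit_v5 h2 hodd hd4 hβ0 hβ1 hzero
  rw [hκ] at hup
  calc (classNumber K : ℝ)
      ≤ 1 / (8 * Real.pi) * Real.sqrt q * Real.log q ^ 2 * (1 / (η * Real.log q)) := hup
    _ = 1 / (8 * Real.pi) * Real.sqrt q * Real.log q / η := by field_simp

end ClassNumber

end Literature.NumberTheory.LFunctions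

end
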